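import Summits.AtomisticToContinuum.Crystallization.Theorems.StrictSplittingRule.Negative.CentrosymmetricShell

/-!
# `StrictSplittingRule` (stmt-AtomisticToContinuum-12560) · Negative II: a strict splitting rule gaps every Bravais lattice

NECESSARY CONDITION carried by the crux `StrictSplittingRule` (route `FreeSplittingCertificates`), lead of
line `birth`: `bravaisGap_of_strictSplittingRule` — if the crux holds then for every hard core `δ > 0`
there is `c > 0` with `e(Λ) ≥ e_∞ + c` for EVERY `δ`-separated Bravais lattice `Λ` (one-point motif);
hence (`StrictSplittingRule_false_of_bravaisGroundState`, the `--negative-modulo` form) a Bravais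
Lennard-Jones configuration with energy per particle `≤ e_∞` (e.g. fcc, were it a ground state) REFUTES
the crux.  Quantitatively the crux pins its strictness constants: `c(a/5) ≤ e(Λ) − e_∞` for every Bravais
`Λ` (numerically `e_fcc* − e_hcp* ≈ 7.25·10⁻⁵`, refuter evidence `lattice_check.out` on the item).

Proof.  At the centre `y` of a large ball of `Λ` (a `δ`-separated finite configuration) the weighted site
energy of ANY rule of radius `R` is `≤ e(Λ) + (3/2)·(absolute tail of the lattice sum beyond ρ − R)`:
bonds to points within `ρ − R` pair off with their reflections through `y`, whose weights sum to one
(complementarity + translation invariance of the joint patterns, file I), so they contribute exactly half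
the plain sum; the annulus is bounded by `|V|`; the plain partial sum is `2e(Λ)` up to the signed tail
(`energyPerParticle` of a one-point motif is half the site lattice sum, absolutely summable by
`summable_lennardJones_dist_three`).  Tails `→ 0` (`tendsto_tsum_compl_atTop_zero`), so for `e(Λ) <
e_∞ + c` the centre's weighted energy drops below `e_∞ + c` and strictness at tolerance `a/5` makes its
first shell — a centrosymmetric set — `(a/5)`-close to `S(a,t)`, which file I forbids.
No definitions; [folklore] bookkeeping around the crux's own text.
-/

noncomputable section

namespace Summit.AtomisticToContinuum.Crystallization.Theorems.StrictSplittingRuleBirth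

open scoped BigOperators Classical
open Literature.MathematicalPhysics.StatisticalMechanics
open Literature.Geometry.DiscreteGeometry

/-- Euclidean `3`-space. -/
local notation "E3" => EuclideanSpace ℝ (Fin 3)

/-! ## Part 4 · The weighted site energy of the centre: pairing bound -/

section SiteBound

variable {P : PeriodicConfiguration 3} {y : E3} {ρ R : ℝ} {N : ℕ} {x : Fin N → E3} {i₀ : Fin N}
  {σ : Fin N → Fin N}

/-- `siteE` written with `bondPattern` (definitional). -/
theorem bravaisGap_siteE_eq (R : ℝ) (Φ : E3 → Finset E3 → ℝ) (x : Fin N → E3) (k : Fin N) :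
    siteE R Φ x k = ∑ j ∈ Finset.univ.erase k,
      Φ (x j - x k) (bondPattern R x k j) * lennardJones (dist (x k) (x j)) :=
  rfl

/-- A weight in `[0,1]` times `V` is at most `|V|`. -/
theorem bravaisGap_weight_mul_le_abs {w V : ℝ} (h0 : 0 ≤ w) (h1 : w ≤ 1) : w * V ≤ |V| := by
  rcases le_or_gt 0 V with hV | hV
  · rw [abs_of_nonneg hV]; nlinarith
  · rw [abs_of_neg hV]; nlinarith

/-- **Pairing bound.**  At the centre of a Bravais ball configuration, for ANY rule `Φ`, the weighted
site energy is at most half the plain sum of `V` over the points within `ρ − R` plus the absolute sum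
of `V` over the points in the annulus `ρ − R < dist ≤ ρ` (near bonds pair off with their reflections,
whose weights sum to one; far bonds are bounded by `|V|`). -/
theorem bravaisGap_siteE_le (hmotif : P.motif = {y}) (hinj : Function.Injective x)
    (hrange : Set.range x = {z | z ∈ P.points ∧ dist z y ≤ ρ}) (hcentre : x i₀ = y)
    (hσ : ∀ j, x (σ j) = y + (y - x j)) {Φ : E3 → Finset E3 → ℝ} (hΦ : IsRule Φ) :
    siteE R Φ x i₀ ≤
      (1 / 2) * ∑ j ∈ (Finset.univ.erase i₀).filter (fun j => dist (x j) y ≤ ρ - R),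
          lennardJones (dist (x i₀) (x j)) +
        ∑ j ∈ (Finset.univ.erase i₀).filter (fun j => ¬ dist (x j) y ≤ ρ - R),
          |lennardJones (dist (x i₀) (x j))| := by
  set near := (Finset.univ.erase i₀).filter (fun j => dist (x j) y ≤ ρ - R) with hnear
  set far := (Finset.univ.erase i₀).filter (fun j => ¬ dist (x j) y ≤ ρ - R) with hfar
  set w : Fin N → ℝ := fun j => Φ (x j - x i₀) (bondPattern R x i₀ j) with hw
  set V : Fin N → ℝ := fun j => lennardJones (dist (x i₀) (x j)) with hV
  have hsplit : siteE R Φ x i₀ = ∑ j ∈ near, w j * V j + ∑ j ∈ far, w j * V j := by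
    rw [bravaisGap_siteE_eq, hnear, hfar, Finset.sum_filter_add_sum_filter_not]
  -- membership facts
  have hmem_near : ∀ j ∈ near, j ≠ i₀ ∧ dist (x j) y ≤ ρ - R := fun j hj => by
    simpa [hnear, Finset.mem_filter] using hj
  have hσnear : ∀ j ∈ near, σ j ∈ near := by
    intro j hj
    obtain ⟨hj0, hjd⟩ := hmem_near j hj
    simp only [hnear, Finset.mem_filter, Finset.mem_erase, Finset.mem_univ, and_true]
    exact ⟨bravaisGap_refl_ne hinj hcentre hσ hj0, by rw [bravaisGap_dist_refl hσ]; exact hjd⟩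
  -- V is reflection invariant, w pairs to one
  have hVσ : ∀ j, V (σ j) = V j := by
    intro j
    simp only [hV, hcentre]
    rw [dist_comm, bravaisGap_dist_refl hσ, dist_comm]
  have hwσ : ∀ j ∈ near, w (σ j) = 1 - w j := by
    intro j hj
    obtain ⟨hj0, hjd⟩ := hmem_near j hj
    have := bravaisGap_weight_add_weight_refl hmotif hinj hrange hcentre hσ hΦ j hj0 hjd
    simp only [hw]
    linarith
  -- reindex the near sum by σ
  have hreindex : ∑ j ∈ near, w j * V j = ∑ j ∈ near, w (σ j) * V (σ j) := by
    refine (Finset.sum_nbij' σ σ hσnear hσnear (fun j _ => bravaisGap_refl_refl hinj hσ j)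
      (fun j _ => bravaisGap_refl_refl hinj hσ j) (fun j _ => rfl)).symm
  have hnear_sum : ∑ j ∈ near, w j * V j = (1 / 2) * ∑ j ∈ near, V j := by
    have h2 : ∑ j ∈ near, w (σ j) * V (σ j) = ∑ j ∈ near, (V j - w j * V j) := by
      refine Finset.sum_congr rfl fun j hj => ?_
      rw [hVσ, hwσ j hj]; ring
    rw [h2, Finset.sum_sub_distrib] at hreindex
    linarith
  -- far bonds
  have hfar_sum : ∑ j ∈ far, w j * V j ≤ ∑ j ∈ far, |V j| := by
    refine Finset.sum_le_sum fun j _ => ?_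
    obtain ⟨h0, h1⟩ := hΦ.1 (x j - x i₀) (bondPattern R x i₀ j)
    exact bravaisGap_weight_mul_le_abs h0 h1
  rw [hsplit, hnear_sum]
  linarith

end SiteBound

/-! ## Part 5 · Lattice sums: the energy per particle and its tails -/

section Sums

variable {P : PeriodicConfiguration 3} {y : E3}

/-- The energy per particle of a Bravais configuration is half the site lattice sum at its point `y`. -/
theorem bravaisGap_energyPerParticle_eq (hmotif : P.motif = {y}) :
    P.energyPerParticle lennardJones =
      (1 / 2) * ∑' z : {z : E3 // z ∈ P.points ∧ z ≠ y}, lennardJones (dist y z.1) := by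
  unfold PeriodicConfiguration.energyPerParticle
  rw [hmotif, Finset.sum_singleton, Finset.card_singleton]
  norm_num

/-- The points of `P` other than `y` within distance `r` of `y` form a finite set (local finiteness). -/
theorem bravaisGap_finite_near (P : PeriodicConfiguration 3) (y : E3) (r : ℝ) :
    {z : {z : E3 // z ∈ P.points ∧ z ≠ y} | dist z.1 y ≤ r}.Finite := by
  have hK : (Metric.closedBall y r ∩ P.points).Finite := P.finite_inter_points Metric.isBounded_closedBall
  refine (hK.preimage Subtype.val_injective.injOn).subset ?_
  intro z hz
  exact ⟨Metric.mem_closedBall.2 hz, z.2.1⟩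

/-- **Tails of the absolute lattice sum are small**: for every `ε > 0` there is `r₀` such that for all
`r ≥ r₀` the absolute Lennard-Jones sum over the points beyond distance `r` is `< ε`. -/
theorem bravaisGap_tail_small (P : PeriodicConfiguration 3) (y : E3) {ε : ℝ} (hε : 0 < ε) :
    ∃ r₀ : ℝ, ∀ r : ℝ, r₀ ≤ r →
      (∑' z : {z : E3 // z ∈ P.points ∧ z ≠ y}, |lennardJones (dist y z.1)|) -
        ∑ z ∈ (bravaisGap_finite_near P y r).toFinset, |lennardJones (dist y z.1)| < ε := by
  set f : {z : E3 // z ∈ P.points ∧ z ≠ y} → ℝ := fun z => lennardJones (dist y z.1) with hf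
  have hsum : Summable f := P.summable_lennardJones_dist_three y
  have habs : Summable fun z => |f z| := hsum.abs
  have ht := tendsto_tsum_compl_atTop_zero (fun z => |f z|)
  have hev : ∀ᶠ s : Finset {z : E3 // z ∈ P.points ∧ z ≠ y} in Filter.atTop,
      (∑' z : {z // z ∉ s}, |f z|) < ε := by
    have := ht.eventually (gt_mem_nhds hε)
    exact this
  obtain ⟨s₀, hs₀⟩ := Filter.eventually_atTop.1 hev
  refine ⟨∑ z ∈ s₀, dist z.1 y, fun r hr => ?_⟩
  set s := (bravaisGap_finite_near P y r).toFinset with hs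
  have hsub : s₀ ≤ s := by
    intro z hz
    rw [hs, Set.Finite.mem_toFinset, Set.mem_setOf_eq]
    refine le_trans ?_ hr
    exact Finset.single_le_sum (f := fun z : {z : E3 // z ∈ P.points ∧ z ≠ y} => dist z.1 y)
      (fun _ _ => dist_nonneg) hz
  have h1 := hs₀ s hsub
  have key := habs.sum_add_tsum_compl (s := s)
  have e : (∑' z : {z // z ∉ s}, |f z|) = ∑' z : ↑((↑s : Set {z : E3 // z ∈ P.points ∧ z ≠ y})ᶜ), |f z| :=
    rfl
  rw [e] at h1
  linarith

/-- Half the partial lattice sum over the points within `r` is at most the energy per particle plus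
half the absolute tail beyond `r`. -/
theorem bravaisGap_half_partial_le (hmotif : P.motif = {y}) (r : ℝ) :
    (1 / 2) * ∑ z ∈ (bravaisGap_finite_near P y r).toFinset, lennardJones (dist y z.1) ≤
      P.energyPerParticle lennardJones +
        (1 / 2) * ((∑' z : {z : E3 // z ∈ P.points ∧ z ≠ y}, |lennardJones (dist y z.1)|) -
          ∑ z ∈ (bravaisGap_finite_near P y r).toFinset, |lennardJones (dist y z.1)|) := by
  set α := {z : E3 // z ∈ P.points ∧ z ≠ y}
  set f : α → ℝ := fun z => lennardJones (dist y z.1) with hf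
  have hsum : Summable f := P.summable_lennardJones_dist_three y
  have habs : Summable fun z => |f z| := hsum.abs
  set s := (bravaisGap_finite_near P y r).toFinset with hs
  have k1 := hsum.sum_add_tsum_compl (s := s)
  have k2 := habs.sum_add_tsum_compl (s := s)
  -- the signed tail is at least minus the absolute tail
  have k3 : -(∑' z : ↑((↑s : Set α)ᶜ), |f z|) ≤ ∑' z : ↑((↑s : Set α)ᶜ), f z := by
    rw [← tsum_neg]
    exact (habs.subtype _).neg.tsum_le_tsum (fun z => neg_abs_le (f z)) (hsum.subtype _)
  rw [bravaisGap_energyPerParticle_eq hmotif]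
  change (1 / 2) * ∑ z ∈ s, f z ≤ (1 / 2) * ∑' z, f z + (1 / 2) * ((∑' z, |f z|) - ∑ z ∈ s, |f z|)
  linarith

end Sums

/-! ## Part 6 · Enumerating a ball of the lattice; the two sum identities -/

section Enumeration

variable {P : PeriodicConfiguration 3} {y : E3} {ρ R : ℝ} {N : ℕ} {x : Fin N → E3} {i₀ : Fin N}

/-- The points of `P` in a closed ball can be enumerated injectively by a `Fin N`. -/
theorem bravaisGap_exists_enumeration (P : PeriodicConfiguration 3) (y : E3) (ρ : ℝ) :
    ∃ (N : ℕ) (x : Fin N → E3), Function.Injective x ∧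
      Set.range x = {z | z ∈ P.points ∧ dist z y ≤ ρ} := by
  have hK : (Metric.closedBall y ρ ∩ P.points).Finite := P.finite_inter_points Metric.isBounded_closedBall
  set F : Finset E3 := hK.toFinset with hF
  have hFmem : ∀ z, z ∈ F ↔ z ∈ P.points ∧ dist z y ≤ ρ := by
    intro z
    rw [hF, Set.Finite.mem_toFinset, Set.mem_inter_iff, Metric.mem_closedBall]
    tauto
  refine ⟨F.card, fun i => ((F.equivFin.symm i : ↥F) : E3),
    fun i j h => F.equivFin.symm.injective (Subtype.ext h), ?_⟩
  ext z
  rw [Set.mem_range, Set.mem_setOf_eq, ← hFmem]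
  constructor
  · rintro ⟨i, rfl⟩; exact (F.equivFin.symm i).2
  · intro hz
    refine ⟨F.equivFin ⟨z, hz⟩, ?_⟩
    show ((F.equivFin.symm (F.equivFin ⟨z, hz⟩) : ↥F) : E3) = z
    rw [Equiv.symm_apply_apply]

/-- **Index sums are lattice partial sums.**  For `r ≤ ρ` and any `g`, the sum of `g (dist (x i₀) (x j))`
over the indices `j ≠ i₀` with `dist (x j) y ≤ r` is the sum of `g (dist y z)` over the points
`z ≠ y` of `P` within `r`. -/
theorem bravaisGap_sum_filter_eq (hinj : Function.Injective x)
    (hrange : Set.range x = {z | z ∈ P.points ∧ dist z y ≤ ρ}) (hcentre : x i₀ = y) (g : ℝ → ℝ)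
    {r : ℝ} (hr : r ≤ ρ) :
    ∑ j ∈ (Finset.univ.erase i₀).filter (fun j => dist (x j) y ≤ r), g (dist (x i₀) (x j)) =
      ∑ z ∈ (bravaisGap_finite_near P y r).toFinset, g (dist y z.1) := by
  have hmem := bravaisGap_index_mem hrange
  have hne : ∀ j, j ≠ i₀ → x j ≠ y := fun j hj h => hj (hinj (h.trans hcentre.symm))
  have hmem_s : ∀ z : {z : E3 // z ∈ P.points ∧ z ≠ y},
      z ∈ (bravaisGap_finite_near P y r).toFinset ↔ dist z.1 y ≤ r := fun z => by
    rw [Set.Finite.mem_toFinset, Set.mem_setOf_eq]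
  refine Finset.sum_bij
    (fun j hj => ⟨x j, (hmem j).1, hne j (Finset.mem_erase.1 (Finset.mem_filter.1 hj).1).1⟩)
    (fun j hj => (hmem_s _).2 (Finset.mem_filter.1 hj).2)
    (fun j₁ _ j₂ _ h => hinj (congrArg (fun z : {z : E3 // z ∈ P.points ∧ z ≠ y} => z.1) h))
    (fun z hz => ?_) (fun j _ => by rw [hcentre])
  have hzd := (hmem_s z).1 hz
  obtain ⟨m, hm⟩ := bravaisGap_exists_index hrange z.2.1 (le_trans hzd hr)
  have hm0 : m ≠ i₀ := fun h => z.2.2 (by rw [← hm, h, hcentre])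
  refine ⟨m, Finset.mem_filter.2 ⟨Finset.mem_erase.2 ⟨hm0, Finset.mem_univ _⟩, ?_⟩, Subtype.ext hm⟩
  rw [hm]; exact hzd

/-- All indices other than the centre are within `ρ`, so the unfiltered index sum is the `ρ`-filtered one. -/
theorem bravaisGap_sum_erase_eq_sum_filter (hrange : Set.range x = {z | z ∈ P.points ∧ dist z y ≤ ρ})
    (G : Fin N → ℝ) :
    ∑ j ∈ Finset.univ.erase i₀, G j = ∑ j ∈ (Finset.univ.erase i₀).filter (fun j => dist (x j) y ≤ ρ), G j := by
  rw [Finset.filter_true_of_mem]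
  intro j _
  exact (bravaisGap_index_mem hrange j).2

/-- **Centre bound in lattice-sum form**: the weighted site energy of the centre of the ball of radius
`ρ` is at most `e(P) + (3/2)·(absolute tail beyond ρ − R)`, for every rule. -/
theorem bravaisGap_centre_siteE_le (hmotif : P.motif = {y}) (hinj : Function.Injective x)
    (hrange : Set.range x = {z | z ∈ P.points ∧ dist z y ≤ ρ}) (hcentre : x i₀ = y) (hR : 0 ≤ R)
    {Φ : E3 → Finset E3 → ℝ} (hΦ : IsRule Φ) :
    siteE R Φ x i₀ ≤ P.energyPerParticle lennardJones +
      (3 / 2) * ((∑' z : {z : E3 // z ∈ P.points ∧ z ≠ y}, |lennardJones (dist y z.1)|) -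
        ∑ z ∈ (bravaisGap_finite_near P y (ρ - R)).toFinset, |lennardJones (dist y z.1)|) := by
  have hRρ : ρ - R ≤ ρ := by linarith
  choose σ hσ using bravaisGap_exists_reflect (x := x) hmotif hrange
  have habs : Summable fun z : {z : E3 // z ∈ P.points ∧ z ≠ y} => |lennardJones (dist y z.1)| :=
    (P.summable_lennardJones_dist_three y).abs
  have hbound := bravaisGap_siteE_le (R := R) hmotif hinj hrange hcentre hσ hΦ
  -- near plain sum and near/full absolute sums as lattice partial sums
  have hnear := bravaisGap_sum_filter_eq hinj hrange hcentre lennardJones hRρ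
  have hnearAbs := bravaisGap_sum_filter_eq hinj hrange hcentre (fun d => |lennardJones d|) hRρ
  have hfullAbs := bravaisGap_sum_filter_eq hinj hrange hcentre (fun d => |lennardJones d|) le_rfl
  have hsplit := Finset.sum_filter_add_sum_filter_not (Finset.univ.erase i₀)
    (fun j => dist (x j) y ≤ ρ - R) (fun j => |lennardJones (dist (x i₀) (x j))|)
  rw [bravaisGap_sum_erase_eq_sum_filter (i₀ := i₀) hrange] at hsplit
  rw [hnearAbs, hfullAbs] at hsplit
  rw [hnear] at hbound
  have hBle := habs.sum_le_tsum (bravaisGap_finite_near P y ρ).toFinset (fun z _ => abs_nonneg _)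
  have hhalf := bravaisGap_half_partial_le hmotif (ρ - R)
  linarith

/-- **The first shell of the centre of a lattice ball is centrosymmetric.** -/
theorem bravaisGap_shell_centrosymmetric (hmotif : P.motif = {y}) (hinj : Function.Injective x)
    (hrange : Set.range x = {z | z ∈ P.points ∧ dist z y ≤ ρ}) (hcentre : x i₀ = y) (a : ℝ) :
    ∀ p ∈ shell a x i₀, -p ∈ shell a x i₀ := by
  choose σ hσ using bravaisGap_exists_reflect (x := x) hmotif hrange
  intro p hp
  simp only [shell, Finset.mem_image, Finset.mem_filter, Finset.mem_univ, true_and] at hp ⊢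
  obtain ⟨j, ⟨hj0, hjd⟩, rfl⟩ := hp
  refine ⟨σ j, ⟨bravaisGap_refl_ne hinj hcentre hσ hj0, ?_⟩, ?_⟩
  · rw [hcentre] at hjd ⊢; rwa [bravaisGap_dist_refl hσ]
  · rw [hσ, hcentre]; abel

end Enumeration

/-! ## Part 7 · The theorem: a strict splitting rule gaps every Bravais lattice -/

/-- **NECESSARY CONDITION CARRIED BY THE CRUX (Bravais gap).**  If `StrictSplittingRule` holds then for
every hard core `δ > 0` there is `c > 0` such that EVERY Bravais lattice (periodic configuration with a
one-point motif) whose points are `δ`-separated has Lennard-Jones energy per particle `≥ e_∞ + c`.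
In particular no Bravais lattice — fcc at any density included — can approach `e_∞`: the crux pins
`c(η) ≤ e(Λ) − e_∞` for every Bravais `Λ` (numerically `e_fcc* − e_hcp* ≈ 7·10⁻⁵`, refuter evidence
`lattice_check.out`), and it would be REFUTED by any Bravais Lennard-Jones ground state.
Proof: take the rule `(R, Φ, a, t)` the crux provides at `δ` and its strictness constant `c` at
tolerance `η = a/5`; if a `δ`-separated Bravais `P` had `e(P) < e_∞ + c`, the centre of a large ball
of `P` (a `δ`-separated finite configuration) would have weighted site energy `≤ e(P) + (3/2)·tail`
(pairing bound: near bonds pair with their reflections, whose weights sum to one by complementarity and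
lattice-translation invariance of the joint patterns) `< e_∞ + c`, so its first shell — a
centrosymmetric set — would be `(a/5)`-close to `S(a,t)`, which Part 1 forbids. -/
theorem bravaisGap_of_strictSplittingRule
    (hS : Summit.AtomisticToContinuum.Crystallization.Theses.FreeSplittingCertificates.StrictSplittingRule) :
    ∀ δ : ℝ, 0 < δ → ∃ c : ℝ, 0 < c ∧ ∀ P : PeriodicConfiguration 3, P.motif.card = 1 →
      (∀ p ∈ P.points, ∀ q ∈ P.points, p ≠ q → δ ≤ dist p q) →
        eInf + c ≤ P.energyPerParticle lennardJones := by
  intro δ hδ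
  rw [strictSplittingRule_iff] at hS
  obtain ⟨R, Φ, a, t, hR, ha, ht, hrule, -, hstrict⟩ := hS δ hδ
  obtain ⟨c, hc, hstr⟩ := hstrict (a / 5) (by positivity)
  refine ⟨c, hc, fun P hcard hsep => ?_⟩
  by_contra hlt
  push Not at hlt
  obtain ⟨y, hmotif⟩ := Finset.card_eq_one.1 hcard
  -- tails of the site lattice sum at `y`
  have hε : 0 < (eInf + c - P.energyPerParticle lennardJones) / 2 := by linarith
  obtain ⟨r₀, hr₀⟩ := bravaisGap_tail_small P y hε
  -- radius, enumeration of the ball, centre index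
  set ρ : ℝ := max r₀ 0 + R with hρ
  have hρR : r₀ ≤ ρ - R := by rw [hρ]; linarith [le_max_left r₀ 0]
  have hρ0 : 0 ≤ ρ := by rw [hρ]; linarith [le_max_right r₀ 0]
  obtain ⟨N, x, hinj, hrange⟩ := bravaisGap_exists_enumeration P y ρ
  obtain ⟨i₀, hcentre⟩ := bravaisGap_exists_index hrange (bravaisGap_centre_mem hmotif)
    (by rw [dist_self]; exact hρ0)
  have hmem := bravaisGap_index_mem hrange
  have hxsep : Sep δ x := fun i j hij => hsep _ (hmem i).1 _ (hmem j).1 (fun h => hij (hinj h))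
  -- the weighted site energy of the centre is below `e_∞ + c`
  have hbound := bravaisGap_centre_siteE_le hmotif hinj hrange hcentre hR.le hrule
  have htail := hr₀ (ρ - R) hρR
  have hsite : siteE R Φ x i₀ < eInf + c := by linarith
  -- strictness: the centre's shell is (a/5)-close to S(a,t) — but it is centrosymmetric
  exact bravaisGap_not_shellCloseTo_of_centrosymmetric ha ht
    (bravaisGap_shell_centrosymmetric hmotif hinj hrange hcentre a) (hstr _ x hxsep i₀ hsite)

/-- **Negative-modulo form.**  A Bravais Lennard-Jones configuration whose energy per particle does not
exceed Fekete's constant `e_∞` (a "Bravais ground state" — e.g. fcc, were it optimal) refutes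
`StrictSplittingRule`: its points are uniformly separated (`PeriodicConfiguration.exists_pos_le_dist`),
so the Bravais gap at that separation is contradicted by `P` itself. -/
theorem StrictSplittingRule_false_of_bravaisGroundState :
    (∃ P : PeriodicConfiguration 3, P.motif.card = 1 ∧ P.energyPerParticle lennardJones ≤ eInf) →
    ¬ Summit.AtomisticToContinuum.Crystallization.Theses.FreeSplittingCertificates.StrictSplittingRule := by
  intro h hS
  obtain ⟨P, hcard, hle⟩ := h
  obtain ⟨δ, hδ, hsep⟩ := P.exists_pos_le_dist
  obtain ⟨c, hc, hgap⟩ := bravaisGap_of_strictSplittingRule hS δ hδ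
  have := hgap P hcard hsep
  linarith

/-- **Registered anchor `stub_bravaisGap`** (binder-free form of `bravaisGap_of_strictSplittingRule`):
the crux forces a uniform energy gap above `e_∞` on all `δ`-separated Bravais lattices. -/
theorem stub_bravaisGap :
    Summit.AtomisticToContinuum.Crystallization.Theses.FreeSplittingCertificates.StrictSplittingRule →
    ∀ δ : ℝ, 0 < δ → ∃ c : ℝ, 0 < c ∧ ∀ P : PeriodicConfiguration 3, P.motif.card = 1 →
      (∀ p ∈ P.points, ∀ q ∈ P.points, p ≠ q → δ ≤ dist p q) →
        eInf + c ≤ P.energyPerParticle lennardJones :=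
  bravaisGap_of_strictSplittingRule

end Summit.AtomisticToContinuum.Crystallization.Theorems.StrictSplittingRuleBirth

end
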